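import Summits.Schanuel.Schanuel.Theorems.RootDecomp1KTrinomialDescent01

/-!
# RootDecomp1KTrinomialDescent — lens 1, generation 64, NODE 25 «TRINOMIAL (FERMAT-QUOTIENT) DESCENT ON THE K-LINE — the curve X3 decided: EMPTY AT EVERY LEVEL» (×0-as-record under RULE K-R51 (i): for every trinomial σ₀Y^d + σ₁2^s·x^i·Y^k + σ₂x^j with Δ = (d−k)(j−i) − i·k odd ≥ 3 and primitive inner edges — the class FermatTri — NO rational point over any dyadic x = p/2^n, p odd, |p| ≠ 1, n ≥ 1, hence no level point for N ≥ 2 ⇒ LevelFinite / ThinFibreAt ∀ m₀ / BddLevelEmpty; X3 = x³ + Y·x + Y⁷ EMPTY at every level N ≥ 0; elementary: unique factorisation + parity; CLAIM L2956, PRICE L2959 (β), ERRATUM E3, RULE K-R56) — continuation (RootDecomp1KTrinomialDescent02): §A arithmetic part 2: the core — per-prime support matching and trinomial_core (section Arithmetic re-opened; section Core with its variables)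

(lens-1 g64 NODE 25 «TRINOMIAL (FERMAT-QUOTIENT) DESCENT ON THE K-LINE — the curve X3 decided: EMPTY AT EVERY LEVEL» L2968: HOME kernel K = HOME/decomp-schanuel-lens-1/g64/lean/TrinomialDescent.lean sha256 e7961d57…, 1095 l, 95 decls, ONE namespace `Summit.Schanuel.Schanuel.Theorems.RootDecomp1KTrinomialDescent`, imports the tree port …RootDecomp1KSuperellipticSiegel06 ONLY; no private, no instance, no set_option, no notation, no sorry, no decide; lens farm: K rc 0 · 0 errors · 0 sorries, Probe rc 0 (155 `#print axioms` guards ⊆ the standard triple), Ctrl0 rc 0, Ctrl rc 1 = 35 planted errors exactly; CLAIM L2956 (ASK-FIRST under K-R55 (iii)); crit g12 PRICE L2959: RULING (β) ×0-AS-RECORD under RULE K-R51 (i) (descent lane: Chevalley–Weil along the étale μ₁₁-torsor defined by the ℚ-rational cuspidal 11-torsion of J_X3 + an elementary step upstairs) — «BUILD, ×0 VERDICT and RECORD PORT WELCOME AND REQUESTED»; ERRATUM E3 (critic's: X3 is NOT open territory — STRUCK as standing witness); RULE K-R56 PRE-ANNOUNCED; CHECKLIST K-g64 (1)–(9); census LIVENESS-v31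 (keys tri / cusp / jac of record L2969: FermatTri YES on X3 only, cuspidal group of order 11, census kit jac: #J_X3(𝔽_p) for p = 5, 13, 23 has gcd exactly 11); writer g34 NOTE 4 L2960 (pre-check 15/15 + 5/5); critic VERDICT: VERIFIED, OF RECORD: ×0-AS-RECORD under RULE K-R51 (i) (the descent lane; no credit class), VERDICT L2971 (crit-1 g12, 2026-09-02T00:18Z): CHECKLIST K-g64 (1)–(9) met item by item on the critic's own farm runs (K rc 0 · 0 errors · 0 sorries; Probe rc 0 with 155 `#print axioms` closures ⊆ the standard triple; Ctrl0 rc 0; Ctrl rc 1 = exactly the 35 planted errors; Pin25.lean 25/25); tally of record UNCHANGED lens-1 ×21 + THEOREM ×23; ERRATUM E3 FINAL (X3 = x³ + Y·x + Y⁷ STRUCK as standing witness: J_X3(ℚ)[11] ∋ [P₁ − P_∞] cuspidal; census jac gcd = 11 at p = 5, 13, 23); RULE K-R56 FIXED (+ the (d2) precision and GLOSS); PORT GO L2973 (×0 RECORD port, census-1; `--supports stmt-Schanuel-33364`, the item stays OPEN). Port by census-1 gen 24 as `RootDecomp1KTrinomialDescent01–05` (`--supports stmt-Schanuel-33364`;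 the item stays OPEN; ×0 record port, no credit anywhere): 01 = §A arithmetic part 1 (section Arithmetic: L1 parity lemmas `odd_geom_sum₂` / `le_geom_sum₂` / `pow_ne_pow_add_two_pow` / `eq_one_of_pow_add_pow_eq_two_pow` / `pow_ne_pow_add_two_pow_both`, valuations, perfect powers; section Arithmetic closed at the cut); 02 = §A part 2 (section Arithmetic re-opened: section Core — `perPrime`, `trinomial_core`); 03 = §B the term `triP` and the class `def FermatTri` (section Trinomial) + §C (M1) the 2-adic descent `den_of_root_triP` / `bev_triP_ne_zero_of_dyadic` (section TwoAdic) + §D the K-line doors `no_level_of_fermatTri` / `levelFinite_of_fermatTri` / `thinFibreAt_of_fermatTri` / `bddLevelEmpty_of_fermatTri` (section KLine); 04 = §F the term of record `X3P` (`bev_X3P`, `fermatTri_X3P`, `no_level_X3P`, `levelSet_X3P_eq_empty`, `levelFinite_X3P`, `thinFibreAt_X3P`, `bddLevelEmpty_X3P`) and the family `FT` (section Witness); 05 = §T territory refusals by tree names (`xdeg_X3P`, `not_domSuper_X3P`, `not_domHyper_X3P`, `den_of_level_X3P`, the class boundary `not_fermatTri_of_two_coeffs`, the nominee `X5P` typed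 as a NON-member) (section Territory) + §N sharpness (section Sharpness). Text = K VERBATIM (every declaration documented by the lens; statements and proofs unchanged; K's module docstring kept in part 01 below this provenance block).)
-/

noncomputable section

namespace Summit.Schanuel.Schanuel.Theorems.RootDecomp1KTrinomialDescent

open Polynomial Finset
open LiouvilleNumber
open scoped Nat
open Summit.Schanuel.Schanuel.Theorems.RootDecomp1KDegreeLadder
open Summit.Schanuel.Schanuel.Theorems.RootDecomp1KXTop
open Summit.Schanuel.Schanuel.Theorems.RootDecomp1KXAll
open Summit.Schanuel.Schanuel.Theorems.RootDecomp1KLevelFinite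
open Summit.Schanuel.Schanuel.Theorems.RootDecomp1KHeightGrading (BddLevelEmpty bddLevelEmpty_iff_levelFinite H17P h17C
  h17C_one)
open Summit.Schanuel.Schanuel.Theorems.RootDecomp1KOddEmpty (levelFinite_of_no_level W4P w4C)
open Summit.Schanuel.Schanuel.Theorems.RootDecomp1KTwoBaseCell (psNumer partialSum_eq_psNumer_div coprime_psNumer)
open Summit.Schanuel.Schanuel.Theorems.RootDecomp1KRelLiouvilleCell (partialSum_two_zero)
open Summit.Schanuel.Schanuel.Theorems.RootDecomp1KRunge (psNumer_pos_runge RW rwC rwC_four)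
open Summit.Schanuel.Schanuel.Theorems.RootDecomp1KSuperellipticSiegel (DomSuper exists_root_septic T tC A xCoeff_T
  tC_zero coeff_A_seven coeff_A_zero twoTermC twoTermP_eq_xPolyP)
open Summit.Schanuel.Schanuel.Theorems.RootDecomp1KHyperellipticSiegel (DomHyper)

/-! (section Arithmetic, continued from part 01 — re-opened) -/

section Arithmetic

/-! ### the core -/

section Core

variable {m i k l Δ : ℕ}

/-- the per-prime support matching: for `P, U` odd with one of the three «sum» relations among
`U^(m+k)`, `2^M P^i U^k`, `P^(l+i)`, at every prime the exponent vector `(v P, v U)` lies on `ℕ·(m, i)` or on `ℕ·(k, l)`. -/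
theorem perPrime (hi : 0 < i) (hk : 0 < k) (hΔ : l * m = Δ + i * k) (hΔ3 : 3 ≤ Δ)
    (hmi : Nat.Coprime m i) (hkl : Nat.Coprime k l) {P U M : ℕ} (hP : Odd P) (hU : Odd U)
    (h : U ^ (m + k) + 2 ^ M * P ^ i * U ^ k = P ^ (l + i) ∨ U ^ (m + k) + P ^ (l + i) = 2 ^ M * P ^ i * U ^ k ∨
      2 ^ M * P ^ i * U ^ k + P ^ (l + i) = U ^ (m + k)) (q : ℕ) :
    ∃ t, (P.factorization q = m * t ∧ U.factorization q = i * t) ∨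
      (P.factorization q = k * t ∧ U.factorization q = l * t) := by
  have hP0 : P ≠ 0 := hP.pos.ne'
  have hU0 : U ≠ 0 := hU.pos.ne'
  have hm : 0 < m := Nat.pos_of_ne_zero fun h0 => by subst h0; simp at hΔ; omega
  by_cases hq : q.Prime
  swap
  · exact ⟨0, Or.inl ⟨by simp [Nat.factorization_eq_zero_of_not_prime _ hq],
      by simp [Nat.factorization_eq_zero_of_not_prime _ hq]⟩⟩
  by_cases hq2 : q = 2
  · subst hq2
    have hP2 : P.factorization 2 = 0 := Nat.factorization_eq_zero_of_not_dvd fun h2 => by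
      have := Nat.odd_iff.mp (hP.of_dvd_nat h2); omega
    have hU2 : U.factorization 2 = 0 := Nat.factorization_eq_zero_of_not_dvd fun h2 => by
      have := Nat.odd_iff.mp (hU.of_dvd_nat h2); omega
    exact ⟨0, Or.inl ⟨by simp [hP2], by simp [hU2]⟩⟩
  -- an odd prime `q`: the valuations of the three terms
  set α := P.factorization q with hα
  set β := U.factorization q with hβ
  have v1 : (U ^ (m + k)).factorization q = (m + k) * β := by
    rw [Nat.factorization_pow]; simp [hβ]
  have v3 : (P ^ (l + i)).factorization q = (l + i) * α := by
    rw [Nat.factorization_pow]; simp [hα]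
  have v2 : (2 ^ M * P ^ i * U ^ k).factorization q = i * α + k * β := by
    rw [Nat.factorization_mul (by positivity) (by positivity), Nat.factorization_mul (by positivity) (by positivity),
      Nat.factorization_pow, Nat.factorization_pow, Nat.factorization_pow, Nat.prime_two.factorization]
    simp [hα, hβ, Finsupp.single_eq_of_ne hq2]
  have hT1 : U ^ (m + k) ≠ 0 := by positivity
  have hT2 : 2 ^ M * P ^ i * U ^ k ≠ 0 := by positivity
  have hT3 : P ^ (l + i) ≠ 0 := by positivity
  -- the two smallest valuations tie
  have tie : (m + k) * β = i * α + k * β ∨ i * α + k * β = (l + i) * α ∨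
      ((m + k) * β = (l + i) * α ∧ (m + k) * β ≤ i * α + k * β) := by
    rcases h with h | h | h
    · have := ties_of_add_eq hq hT1 hT2 h; rw [v1, v2, v3] at this; omega
    · have := ties_of_add_eq hq hT1 hT3 h; rw [v1, v2, v3] at this; omega
    · have := ties_of_add_eq hq hT2 hT3 h; rw [v1, v2, v3] at this; omega
  rcases tie with e | e | ⟨e1, e2⟩
  · -- type I: m β = i α
    have e' : m * β = i * α := by linarith
    have hdvd : m ∣ α * i := ⟨β, by linarith⟩
    obtain ⟨t, ht⟩ := hmi.dvd_of_dvd_mul_right hdvd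
    refine ⟨t, Or.inl ⟨ht, ?_⟩⟩
    rw [ht] at e'
    exact Nat.eq_of_mul_eq_mul_left hm (by linarith)
  · -- type II: k β = l α
    have e' : k * β = l * α := by linarith
    have hdvd : k ∣ α * l := ⟨β, by linarith⟩
    obtain ⟨t, ht⟩ := hkl.dvd_of_dvd_mul_right hdvd
    refine ⟨t, Or.inr ⟨ht, ?_⟩⟩
    rw [ht] at e'
    exact Nat.eq_of_mul_eq_mul_left hk (by linarith)
  · -- the outer tie forces α = β = 0
    have hmb : m * β ≤ i * α := by linarith
    have hla : l * α ≤ k * β := by linarith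
    have h1 : l * m * (α * β) ≤ i * k * (α * β) := by
      calc l * m * (α * β) = (m * β) * (l * α) := by ring
        _ ≤ (i * α) * (k * β) := Nat.mul_le_mul hmb hla
        _ = i * k * (α * β) := by ring
    rw [hΔ, add_mul] at h1
    have h0 : Δ * (α * β) = 0 := by
      set c := i * k * (α * β); set d := Δ * (α * β); omega
    rcases Nat.mul_eq_zero.mp h0 with h0 | h0
    · omega
    rcases Nat.mul_eq_zero.mp h0 with h0 | h0
    · refine ⟨0, Or.inl ⟨by simp [h0], ?_⟩⟩
      rw [h0] at e1; simp at e1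
      rcases e1 with e1 | e1
      · omega
      · simp [e1]
    · refine ⟨0, Or.inl ⟨?_, by simp [h0]⟩⟩
      rw [h0] at e1; simp at e1
      rcases e1 with e1 | e1
      · omega
      · simp [e1]

/-- **(L2) THE TRINOMIAL CORE** (PRICE K-g64 (2) (L2)): for `P, U` odd satisfying one of the three sign shapes of
`±U^(m+k) ± 2^M·P^i·U^k ± P^(l+i) = 0` — hypotheses EXACTLY `0 < i`, `0 < k`, `l·m = Δ + i·k`, `Δ` odd, `3 ≤ Δ`, `m ⊥ i`,
`k ⊥ l`, `Odd P`, `Odd U` (NO size, bound or coprimality-of-`P`-and-`U` hypothesis; `0 < m`, `0 < l` FOLLOW) — `P = U = 1`. -/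
theorem trinomial_core (hi : 0 < i) (hk : 0 < k) (hΔ : l * m = Δ + i * k) (hΔo : Odd Δ) (hΔ3 : 3 ≤ Δ)
    (hmi : Nat.Coprime m i) (hkl : Nat.Coprime k l) {P U M : ℕ} (hP : Odd P) (hU : Odd U)
    (h : U ^ (m + k) + 2 ^ M * P ^ i * U ^ k = P ^ (l + i) ∨ U ^ (m + k) + P ^ (l + i) = 2 ^ M * P ^ i * U ^ k ∨
      2 ^ M * P ^ i * U ^ k + P ^ (l + i) = U ^ (m + k)) :
    P = 1 ∧ U = 1 := by
  have hP0 : P ≠ 0 := hP.pos.ne'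
  have hU0 : U ≠ 0 := hU.pos.ne'
  have hm : 0 < m := Nat.pos_of_ne_zero fun h0 => by subst h0; simp at hΔ; omega
  have hl : 0 < l := Nat.pos_of_ne_zero fun h0 => by subst h0; simp at hΔ; omega
  have pp := perPrime hi hk hΔ hΔ3 hmi hkl hP hU h
  -- G1: U^k ∣ P^l ;  G2: P^i ∣ U^m
  have G1 : U ^ k ∣ P ^ l := by
    rw [← Nat.factorization_le_iff_dvd (by positivity) (by positivity), Finsupp.le_def]
    intro q
    rw [Nat.factorization_pow, Nat.factorization_pow, Finsupp.smul_apply, Finsupp.smul_apply, smul_eq_mul, smul_eq_mul]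
    obtain ⟨t, ⟨h1, h2⟩ | ⟨h1, h2⟩⟩ := pp q <;> rw [h1, h2]
    · nlinarith
    · nlinarith
  have G2 : P ^ i ∣ U ^ m := by
    rw [← Nat.factorization_le_iff_dvd (by positivity) (by positivity), Finsupp.le_def]
    intro q
    rw [Nat.factorization_pow, Nat.factorization_pow, Finsupp.smul_apply, Finsupp.smul_apply, smul_eq_mul, smul_eq_mul]
    obtain ⟨t, ⟨h1, h2⟩ | ⟨h1, h2⟩⟩ := pp q <;> rw [h1, h2]
    · nlinarith
    · nlinarith
  set A := P ^ l / U ^ k with hA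
  set B := U ^ m / P ^ i with hB
  have hAU : A * U ^ k = P ^ l := Nat.div_mul_cancel G1
  have hBP : B * P ^ i = U ^ m := Nat.div_mul_cancel G2
  have hA0 : A ≠ 0 := fun h0 => by rw [h0, zero_mul] at hAU; exact absurd hAU.symm (by positivity)
  have hB0 : B ≠ 0 := fun h0 => by rw [h0, zero_mul] at hBP; exact absurd hBP.symm (by positivity)
  -- Δ divides every exponent of A and of B
  have GA : ∀ q, Δ ∣ A.factorization q := by
    intro q
    rw [hA, Nat.factorization_div G1, Finsupp.tsub_apply, Nat.factorization_pow, Nat.factorization_pow,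
      Finsupp.smul_apply, Finsupp.smul_apply, smul_eq_mul, smul_eq_mul]
    obtain ⟨t, ⟨h1, h2⟩ | ⟨h1, h2⟩⟩ := pp q <;> rw [h1, h2]
    · exact ⟨t, by
        have : l * (m * t) = Δ * t + k * (i * t) := by
          calc l * (m * t) = (l * m) * t := by ring
            _ = (Δ + i * k) * t := by rw [hΔ]
            _ = Δ * t + k * (i * t) := by ring
        omega⟩
    · exact ⟨0, by rw [show l * (k * t) = k * (l * t) by ring]; simp⟩
  have GB : ∀ q, Δ ∣ B.factorization q := by
    intro q
    rw [hB, Nat.factorization_div G2, Finsupp.tsub_apply, Nat.factorization_pow, Nat.factorization_pow,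
      Finsupp.smul_apply, Finsupp.smul_apply, smul_eq_mul, smul_eq_mul]
    obtain ⟨t, ⟨h1, h2⟩ | ⟨h1, h2⟩⟩ := pp q <;> rw [h1, h2]
    · exact ⟨0, by rw [show m * (i * t) = i * (m * t) by ring]; simp⟩
    · exact ⟨t, by
        have : m * (l * t) = Δ * t + i * (k * t) := by
          calc m * (l * t) = (l * m) * t := by ring
            _ = (Δ + i * k) * t := by rw [hΔ]
            _ = Δ * t + i * (k * t) := by ring
        omega⟩
  obtain ⟨a, ha⟩ := exists_pow_eq_of_dvd_factorization hA0 GA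
  obtain ⟨b, hb⟩ := exists_pow_eq_of_dvd_factorization hB0 GB
  have hΔ0 : Δ ≠ 0 := by omega
  -- a, b odd
  have hAodd : Odd A := (hP.pow (n := l)).of_dvd_nat (Dvd.intro _ hAU)
  have hBodd : Odd B := (hU.pow (n := m)).of_dvd_nat (Dvd.intro _ hBP)
  have haodd : Odd a := by
    rw [← ha] at hAodd
    exact (Nat.odd_pow_iff hΔ0).mp hAodd
  have hbodd : Odd b := by
    rw [← hb] at hBodd
    exact (Nat.odd_pow_iff hΔ0).mp hBodd
  -- the core equation divided by P^i U^k
  have hPU : P ^ i * U ^ k ≠ 0 := by positivity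
  have eT1 : U ^ (m + k) = B * (P ^ i * U ^ k) := by rw [pow_add, ← hBP]; ring
  have eT3 : P ^ (l + i) = A * (P ^ i * U ^ k) := by rw [pow_add, ← hAU]; ring
  have eT2 : 2 ^ M * P ^ i * U ^ k = 2 ^ M * (P ^ i * U ^ k) := by ring
  rcases h with h | h | h
  · -- B + 2^M = A
    rw [eT1, eT2, eT3, ← add_mul] at h
    have e := Nat.eq_of_mul_eq_mul_right (Nat.pos_of_ne_zero hPU) h
    rw [← ha, ← hb] at e
    exact absurd e.symm (pow_ne_pow_add_two_pow haodd hbodd hΔo hΔ3 M)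
  · -- B + A = 2^M
    rw [eT1, eT2, eT3, ← add_mul] at h
    have e := Nat.eq_of_mul_eq_mul_right (Nat.pos_of_ne_zero hPU) h
    rw [← ha, ← hb, add_comm] at e
    obtain ⟨ha1, hb1⟩ := eq_one_of_pow_add_pow_eq_two_pow haodd hbodd hΔo hΔ3 e
    rw [ha1, one_pow] at ha
    rw [hb1, one_pow] at hb
    -- A = 1, B = 1 :  P^l = U^k and U^m = P^i
    have e1 : P ^ l = U ^ k := by rw [← hAU, ← ha, one_mul]
    have e2 : U ^ m = P ^ i := by rw [← hBP, ← hb, one_mul]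
    have e3 : P ^ (l * m) = P ^ (i * k) := by
      rw [pow_mul, e1, ← pow_mul, mul_comm k m, pow_mul, e2, ← pow_mul]
    have hP1 : P = 1 := by
      by_contra hP1
      have hP2 : 2 ≤ P := by have := hP.pos; omega
      have := Nat.pow_right_injective hP2 e3
      omega
    refine ⟨hP1, ?_⟩
    rw [hP1, one_pow] at e1
    exact (Nat.pow_eq_one.mp e1.symm).resolve_right hk.ne'
  · -- 2^M + A = B
    rw [eT1, eT2, eT3, ← add_mul] at h
    have e := Nat.eq_of_mul_eq_mul_right (Nat.pos_of_ne_zero hPU) h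
    rw [← ha, ← hb, add_comm] at e
    exact absurd e.symm (pow_ne_pow_add_two_pow hbodd haodd hΔo hΔ3 M)

end Core

end Arithmetic

end Summit.Schanuel.Schanuel.Theorems.RootDecomp1KTrinomialDescent

end
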